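import Mathlib
import HarnessLib

/-!
# Lai–Yu 2020, Proposition 3.1: `q`-adic valuation of a product of consecutive terms of an
arithmetic progression — proofs

Topic `Literature/NumberTheory/Irrationality/LaiYu2020`. Companion ("Proofs") file of
`NumberOfIrrationalOddZetaValues.lean`, for L. Lai, P. Yu, *A note on the number of irrational odd
zeta values*, Compositio Math. **156** (2020) 1699–1717 = arXiv:1911.08458 [LaiYu2020], §3
("Arithmetic lemmas"), read on the page (arXiv text p. 6):

> «The following proposition is elementary, we omit the proof:
> **Proposition 3.1.** Let `L ∈ ℕ ∪ {0}`. Suppose `x₁, x₂, ⋯, x_L` be any `L` consecutive terms in an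
> integer arithmetic progression with common difference `b ∈ ℕ`, then for any prime `q ∤ b`, we have
> `v_q(x₁x₂⋯x_L) ≥ ∑_{i=1}^{∞} ⌊L/q^i⌋`.
> In the degenerate case of `L = 0`, we view `x₁x₂⋯x_L = 1`.»

It is the input of Proposition 3.2 there (`d_n^ℓ · [t^ℓ] F̃_{b,a}(t−k) ∈ ℤ`, where
`F_{b,a}(t) = ∏_{p∣b} p^{(2r+1)n/(p−1)} / (n/den r)!^{den(r)(2r+1)} · ∏_j (bt − brn + a + bj)`), and the
classical source of the normalising factor `∏_{p ∣ b} p^{⌊L/(p−1)⌋}` of linear forms with rational shifts.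
PROVED here (theorems only, no definitions, no named facts; sorry-free), in divisibility form (which
also covers a vanishing product):

* `prime_pow_dvd_prod_progression` — **Proposition 3.1**: `q^{v_q(L!)} ∣ ∏_{j<L} (x + jb)` for every
  prime `q ∤ b` (`v_q(L!) = ∑_{i ≥ 1} ⌊L/q^i⌋`, Legendre), and `prop31`, the same with the printed
  exponent `∑_{i=1}^{L} ⌊L/q^i⌋`;
* `padicValNat_factorial_le_div` — the complement at the primes `q ∣ b`: `v_q(L!) ≤ ⌊L/(q−1)⌋`;
* `factorial_dvd_primeFactors_pow_mul_prod_progression` — the assembled classical corollary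
  `L! ∣ ∏_{p ∣ b} p^{⌊L/(p−1)⌋} · ∏_{j<L} (x + jb)` (`b ≥ 1`), i.e.
  `b^L (x/b)_L ∏_{p∣b} p^{⌊L/(p−1)⌋} / L! ∈ ℤ`.

Proof of Proposition 3.1 (the omitted elementary argument): modulo `q^k`, `k = v_q(L!)`, the
difference `b` is invertible, `d b ≡ 1`; then `d^L ∏_j (x + jb) ≡ ∏_j (dx + j)`, a product of `L`
consecutive integers, divisible by `L!`, hence by `q^k`; and `d` is prime to `q`.

## References

* [LaiYu2020] L. Lai, P. Yu, Compositio Math. 156 (2020) 1699–1717, §3 Prop. 3.1 (and its use in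
  Prop. 3.2).
-/

open Finset Nat

namespace Literature.NumberTheory.Irrationality.LaiYu2020

/-- `L! ∣ ∏_{j<L} (y + j)` for every integer `y` (a product of `L` consecutive integers).
[folklore] -/
private theorem factorial_dvd_prod_consecutive (y : ℤ) (L : ℕ) :
    (L ! : ℤ) ∣ ∏ j ∈ range L, (y + j) := by
  have h1 : ∏ j ∈ range L, (y + j) = (descPochhammer ℤ L).eval (y + L - 1) := by
    rw [descPochhammer_eval_eq_prod_range, ← prod_range_reflect]
    refine prod_congr rfl fun j hj => ?_
    have hj' : j < L := mem_range.1 hj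
    push_cast [Nat.cast_sub (by omega : j ≤ L - 1), Nat.cast_sub (by omega : 1 ≤ L)]
    ring
  rw [h1]
  have h := Ring.descPochhammer_eq_factorial_smul_choose (R := ℤ) (y + L - 1) L
  rw [← Polynomial.eval_eq_smeval] at h
  rw [h, nsmul_eq_mul]
  exact dvd_mul_right _ _

/-- **Lai–Yu 2020, Proposition 3.1** (PROVED; "elementary, we omit the proof"): if `q` is a prime
not dividing the common difference `b`, then `q^{v_q(L!)}` divides the product `∏_{j<L} (x + jb)` of
any `L` consecutive terms of an integer arithmetic progression with difference `b`
(`v_q(L!) = ∑_{i≥1} ⌊L/q^i⌋` by Legendre's formula; `L = 0`: empty product `1`).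
[cite: LaiYu2020, Prop. 3.1] -/
theorem prime_pow_dvd_prod_progression {q : ℕ} (hq : q.Prime) {b : ℤ} (hqb : ¬ (q : ℤ) ∣ b)
    (x : ℤ) (L : ℕ) :
    (q : ℤ) ^ padicValNat q L ! ∣ ∏ j ∈ range L, (x + j * b) := by
  set k := padicValNat q L ! with hk
  -- `b` is invertible modulo `q^k`
  have hirr : Irreducible (q : ℤ) := (Nat.prime_iff_prime_int.1 hq).irreducible
  have hcop : IsCoprime b ((q : ℤ) ^ k) := hirr.coprime_pow_of_not_dvd k hqb
  obtain ⟨d, c, hdc⟩ := hcop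
  -- `hdc : d * b + c * q^k = 1`
  have hd : IsCoprime d ((q : ℤ) ^ k) := ⟨b, c, by linarith [mul_comm d b]⟩
  -- `d^L ∏ (x + jb) ≡ ∏ (dx + j) (mod q^k)`
  have h1 : d * b ≡ 1 [ZMOD ((q : ℤ) ^ k)] :=
    Int.modEq_iff_dvd.2 ⟨c, by linear_combination (-1 : ℤ) * hdc⟩
  have e : (∏ j ∈ range L, (x + j * b)) * d ^ L = ∏ j ∈ range L, ((x + j * b) * d) := by
    rw [prod_mul_distrib, prod_const, card_range]
  have hmod : (∏ j ∈ range L, (x + j * b)) * d ^ L ≡ ∏ j ∈ range L, (d * x + j)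
      [ZMOD ((q : ℤ) ^ k)] := by
    rw [e]
    refine Int.ModEq.prod fun j _ => ?_
    calc (x + j * b) * d = d * x + j * (d * b) := by ring
      _ ≡ d * x + j * 1 [ZMOD ((q : ℤ) ^ k)] := (h1.mul_left _).add_left _
      _ = d * x + j := by ring
  -- `q^k ∣ L! ∣ ∏ (dx + j)`
  have hqL : ((q : ℤ) ^ k) ∣ (L ! : ℤ) := by
    have := pow_padicValNat_dvd (p := q) (n := L !)
    exact_mod_cast this
  have hdvd : ((q : ℤ) ^ k) ∣ ∏ j ∈ range L, (d * x + j) :=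
    hqL.trans (factorial_dvd_prod_consecutive (d * x) L)
  have h2 : ((q : ℤ) ^ k) ∣ (∏ j ∈ range L, (x + j * b)) * d ^ L := by
    have := dvd_add (Int.ModEq.dvd hmod.symm) hdvd
    rwa [sub_add_cancel] at this
  exact (hd.pow_left.symm).dvd_of_dvd_mul_right h2

/-- **Proposition 3.1 with the printed exponent** `∑_{i=1}^{L} ⌊L/q^i⌋` (`= ∑_{i=1}^{∞} ⌊L/q^i⌋`, the
terms with `q^i > L` vanish). [cite: LaiYu2020, Prop. 3.1] -/
theorem prop31 {q : ℕ} (hq : q.Prime) {b : ℤ} (hqb : ¬ (q : ℤ) ∣ b) (x : ℤ) (L : ℕ) :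
    (q : ℤ) ^ (∑ i ∈ Ico 1 (L + 1), L / q ^ i) ∣ ∏ j ∈ range L, (x + j * b) := by
  haveI : Fact q.Prime := ⟨hq⟩
  rw [← padicValNat_factorial (Nat.lt_succ_of_le (Nat.log_le_self q L))]
  exact prime_pow_dvd_prod_progression hq hqb x L

/-- The complement at the primes dividing `b`: `v_q(L!) ≤ ⌊L/(q−1)⌋` (Legendre:
`(q−1) v_q(L!) = L − s_q(L)`); in the source this is the remark "for a prime `q ∣ b`, the `q`-adic
order of the factor `∏_{p∣b} p^{(2r+1)n/(p−1)} / (n/den r)!^{den(r)(2r+1)}` is nonnegative".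
[cite: LaiYu2020, Prop. 3.2 (proof, the primes q ∣ b)] -/
theorem padicValNat_factorial_le_div {q : ℕ} (hq : q.Prime) (L : ℕ) :
    padicValNat q L ! ≤ L / (q - 1) := by
  haveI : Fact q.Prime := ⟨hq⟩
  have h := sub_one_mul_padicValNat_factorial (p := q) L
  have hq1 : 0 < q - 1 := by have := hq.two_le; omega
  rw [Nat.le_div_iff_mul_le hq1, mul_comm]
  omega

/-- **The classical corollary** (the normalising factor of linear forms with rational shifts, as in
Lai–Yu's `F_{b,a}`): for `b ≥ 1` and every integer `x`,
`L! ∣ ∏_{p ∣ b} p^{⌊L/(p−1)⌋} · ∏_{j<L} (x + jb)`; equivalently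
`b^L (x/b)_L ∏_{p∣b} p^{⌊L/(p−1)⌋} / L! ∈ ℤ`. (Prime by prime: Proposition 3.1 at `q ∤ b`,
`v_q(L!) ≤ ⌊L/(q−1)⌋` at `q ∣ b`.) [cite: LaiYu2020, Prop. 3.1 with Prop. 3.2 (proof, the primes q ∣ b)] -/
theorem factorial_dvd_primeFactors_pow_mul_prod_progression (b : ℕ) (hb : 0 < b) (x : ℤ) (L : ℕ) :
    (L ! : ℤ) ∣ (∏ p ∈ b.primeFactors, (p : ℤ) ^ (L / (p - 1))) * ∏ j ∈ range L, (x + j * b) := by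
  set M : ℤ := ∏ p ∈ b.primeFactors, (p : ℤ) ^ (L / (p - 1)) with hM
  set P : ℤ := ∏ j ∈ range L, (x + j * b) with hP
  rw [Int.natCast_dvd, Nat.dvd_iff_prime_pow_dvd_dvd]
  intro p k hp hpk
  haveI : Fact p.Prime := ⟨hp⟩
  rw [← Int.natCast_dvd, Nat.cast_pow]
  have hk : k ≤ padicValNat p L ! := (padicValNat_dvd_iff_le (factorial_ne_zero L)).1 hpk
  by_cases hpb : p ∣ b
  · -- `p^k ∣ p^{⌊L/(p-1)⌋} ∣ M`
    have h1 : k ≤ L / (p - 1) := hk.trans (padicValNat_factorial_le_div hp L)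
    have h2 : (p : ℤ) ^ (L / (p - 1)) ∣ M := by
      rw [hM]
      exact dvd_prod_of_mem _ (Nat.mem_primeFactors.2 ⟨hp, hpb, hb.ne'⟩)
    exact dvd_mul_of_dvd_left ((pow_dvd_pow _ h1).trans h2) _
  · -- `p^k ∣ p^{v_p(L!)} ∣ P` (Proposition 3.1)
    have hpb' : ¬ (p : ℤ) ∣ (b : ℤ) := by rwa [Int.natCast_dvd_natCast]
    have h2 := prime_pow_dvd_prod_progression hp hpb' x L
    exact dvd_mul_of_dvd_right ((pow_dvd_pow _ hk).trans h2) _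

/-! ### Proposition 3.2 (coefficients of a shifted progression polynomial)

[LaiYu2020, §3 Prop. 3.2]: «For any nonnegative integers `ℓ` and `k`, we have
`d_n^ℓ · [t^ℓ](F̃_{b,a}(t−k)) ∈ ℤ`», where
`F_{b,a}(t) = ∏_{p∣b} p^{(2r+1)n/(p−1)} / (n/den r)!^{den(r)(2r+1)} · ∏_{j=0}^{(2r+1)n−1} (bt − brn + a + bj)`
and `d_n = lcm(1, …, n)`. Printed proof: for `q ∣ b` the normalising factor has nonnegative `q`-adic
order; for `q ∤ b`, `[t^ℓ] ∏_j (b(t−k) − brn + a + bj)` is a sum of terms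
`b^ℓ ∏_{i=1}^{ℓ+1} ∏_{j ∈ J_i} (−bk − brn + a + bj)` over the complements of `ℓ`-subsets, and by
Proposition 3.1 (counting, for each `i ≥ 1`, the multiples of `q^i` that survive the removal of `ℓ`
indices: at least `⌊(2r+1)n/q^i⌋ − ℓ`) their `q`-adic order is
`≥ ∑_{i ≤ log_q n} (⌊(2r+1)n/q^i⌋ − ℓ) ≥ v_q((n/den r)!^{den(r)(2r+1)}) − ℓ v_q(d_n)`.
We prove it in the general form the argument gives — progression `y₀ + bj` of length `M`, block
length `m` (`= n/den r`), any common multiple `D` of `1, …, m` (`= d_n`, as `m ≤ n`):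
`(m!)^{⌊M/m⌋} ∣ D^ℓ · ∏_{p∣b} p^{⌊M/(p−1)⌋} · [X^ℓ] ∏_{j<M} (bX + y₀ + bj)`; Lai–Yu's statement is the
case `M = (2r+1)n`, `m = n/den(r)` (so `⌊M/m⌋ = den(r)(2r+1)`, `⌊M/(p−1)⌋ = (2r+1)n/(p−1)`),
`y₀ = a − b(rn + k)`. -/

/-- Counting the multiples of `q^t` in a progression with difference prime to `q`: at least `⌊M/q^t⌋`
of `y₀, y₀ + b, …, y₀ + (M−1)b` are divisible by `q^t`. [folklore] -/
private theorem div_le_card_filter_dvd {q : ℕ} (hq : q.Prime) {b : ℤ} (hqb : ¬ (q : ℤ) ∣ b)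
    (y₀ : ℤ) (M t : ℕ) :
    M / q ^ t ≤ ((range M).filter fun j : ℕ => ((q : ℤ) ^ t ∣ y₀ + b * j)).card := by
  classical
  set Q : ℕ := q ^ t with hQ
  have hQpos : 0 < Q := pow_pos hq.pos t
  have hQz : (0 : ℤ) < (Q : ℤ) := by exact_mod_cast hQpos
  have hirr : Irreducible (q : ℤ) := (Nat.prime_iff_prime_int.1 hq).irreducible
  obtain ⟨d, c, hdc⟩ := hirr.coprime_pow_of_not_dvd t hqb
  -- `hdc : d * b + c * q^t = 1`; the residue `r ≡ -y₀ d (mod Q)`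
  set r : ℕ := ((-y₀ * d) % (Q : ℤ)).toNat with hr
  have hr' : (r : ℤ) = (-y₀ * d) % (Q : ℤ) := Int.toNat_of_nonneg (Int.emod_nonneg _ hQz.ne')
  have hrQ : r < Q := by
    have := Int.emod_lt_of_pos (-y₀ * d) hQz
    omega
  have hQcast : ((q : ℤ) ^ t) = (Q : ℤ) := by rw [hQ]; push_cast; ring
  calc M / q ^ t = (range (M / Q)).card := by rw [card_range]
    _ ≤ ((range M).filter fun j : ℕ => ((q : ℤ) ^ t ∣ y₀ + b * j)).card := by
      refine Finset.card_le_card_of_injOn (fun i => r + Q * i) (fun i hi => ?_) ?_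
      · rw [mem_coe, mem_range] at hi
        rw [mem_coe, mem_filter, mem_range]
        refine ⟨?_, ?_⟩
        · have h1 := Nat.div_mul_le_self M Q
          have h2 : Q * (i + 1) ≤ Q * (M / Q) := Nat.mul_le_mul_left _ hi
          nlinarith
        · -- `y₀ + b (r + Q i) = y₀ (1 - d b) + … ≡ 0`
          rw [hQcast]
          have e1 : (r : ℤ) = -y₀ * d - (Q : ℤ) * ((-y₀ * d) / (Q : ℤ)) := by
            rw [hr', Int.emod_def]
          refine ⟨y₀ * c * (q : ℤ) ^ t / (Q : ℤ) * 1 * 0 + (y₀ * c - b * ((-y₀ * d) / (Q : ℤ)) + b * i), ?_⟩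
          push_cast
          rw [e1]
          linear_combination (-y₀) * hdc + y₀ * c * hQcast
      · intro i _ i' _ h
        have : Q * i = Q * i' := by simpa using h
        exact Nat.eq_of_mul_eq_mul_left hQpos this

/-- `v_q` of a product over a finset of nonzero integers is the sum of the `v_q`. [folklore] -/
private theorem padicValInt_prod {q : ℕ} [Fact q.Prime] {ι : Type*} (s : Finset ι) (f : ι → ℤ)
    (hf : ∀ i ∈ s, f i ≠ 0) : padicValInt q (∏ i ∈ s, f i) = ∑ i ∈ s, padicValInt q (f i) := by
  classical
  induction s using Finset.induction_on with
  | empty => simp [padicValInt]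
  | insert a s ha ih =>
    rw [prod_insert ha, sum_insert ha, padicValInt.mul (hf a (mem_insert_self a s))
      (prod_ne_zero_iff.2 fun i hi => hf i (mem_insert_of_mem hi)),
      ih fun i hi => hf i (mem_insert_of_mem hi)]

/-- The number of `t ∈ [1, T]` with `q^t ∣ y` is at most `v_q(y)` (`y ≠ 0`). [folklore] -/
private theorem card_filter_pow_dvd_le {q : ℕ} [Fact q.Prime] {y : ℤ} (hy : y ≠ 0) (T : ℕ) :
    ((Ico 1 (T + 1)).filter fun t : ℕ => (q : ℤ) ^ t ∣ y).card ≤ padicValInt q y := by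
  calc ((Ico 1 (T + 1)).filter fun t : ℕ => (q : ℤ) ^ t ∣ y).card
      ≤ (Ico 1 (padicValInt q y + 1)).card := by
        refine card_le_card fun t ht => ?_
        rw [mem_filter, mem_Ico] at ht
        rw [mem_Ico]
        have := ((padicValInt_dvd_iff t y).1 ht.2).resolve_left hy
        omega
    _ = padicValInt q y := by rw [Nat.card_Ico]; omega

/-- **The counting core of Proposition 3.2**: for `q ∤ b`, a sub-product of the progression missing
at most `ℓ` of the `M` terms, times `D^ℓ` (`D` a common multiple of `1, …, m`), is divisible by
`q^{⌊M/m⌋ v_q(m!)}`. [cite: LaiYu2020, Prop. 3.2 (proof, the primes q ∤ b)] -/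
theorem prime_pow_dvd_pow_mul_subprod {q : ℕ} (hq : q.Prime) {b : ℤ} (hqb : ¬ (q : ℤ) ∣ b)
    (y₀ : ℤ) {M m D ℓ : ℕ} (hm : 0 < m) (hD : ∀ i : ℕ, 1 ≤ i → i ≤ m → i ∣ D)
    {S : Finset ℕ} (hS : S ⊆ range M) (hcard : M ≤ S.card + ℓ) :
    (q : ℤ) ^ (M / m * padicValNat q m !) ∣ (D : ℤ) ^ ℓ * ∏ j ∈ S, (y₀ + b * j) := by
  classical
  haveI : Fact q.Prime := ⟨hq⟩
  -- trivial cases: a vanishing factor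
  by_cases hzero : ∃ j ∈ S, y₀ + b * j = 0
  · obtain ⟨j, hj, h0⟩ := hzero
    rw [prod_eq_zero hj h0, mul_zero]
    exact dvd_zero _
  push Not at hzero
  by_cases hDℓ : (D : ℤ) ^ ℓ = 0
  · rw [hDℓ, zero_mul]; exact dvd_zero _
  have hprod : ∏ j ∈ S, (y₀ + b * j) ≠ 0 := prod_ne_zero_iff.2 hzero
  rw [padicValInt_dvd_iff]
  refine Or.inr ?_
  rw [padicValInt.mul hDℓ hprod, padicValInt_prod S _ hzero]
  -- the chain of inequalities, with `T = log_q m`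
  set T := Nat.log q m with hT
  -- (v) `⌊M/m⌋ v_q(m!) ≤ ∑_{t ≤ T} ⌊M/q^t⌋`
  have h5 : M / m * padicValNat q m ! ≤ ∑ t ∈ Ico 1 (T + 1), M / q ^ t := by
    rw [padicValNat_factorial (Nat.lt_succ_self _), mul_sum]
    refine sum_le_sum fun t _ => ?_
    calc M / m * (m / q ^ t) ≤ M / m * m / q ^ t := Nat.mul_div_le_mul_div_assoc _ _ _
      _ ≤ M / q ^ t := Nat.div_le_div_right (Nat.div_mul_le_self M m)
  -- (iii)+(iv) `⌊M/q^t⌋ ≤ #{j ∈ S : q^t ∣ y_j} + ℓ`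
  have h34 : ∀ t : ℕ, M / q ^ t ≤ (S.filter fun j : ℕ => (q : ℤ) ^ t ∣ y₀ + b * (j : ℤ)).card + ℓ := by
    intro t
    refine (div_le_card_filter_dvd hq hqb y₀ M t).trans ?_
    have hsub : ((range M).filter fun j : ℕ => (q : ℤ) ^ t ∣ y₀ + b * (j : ℤ)) ⊆
        (S.filter fun j : ℕ => (q : ℤ) ^ t ∣ y₀ + b * (j : ℤ)) ∪ (range M \ S) := by
      intro j hj
      rw [mem_filter] at hj
      rw [mem_union, mem_filter, mem_sdiff]
      by_cases hjS : j ∈ S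
      · exact Or.inl ⟨hjS, hj.2⟩
      · exact Or.inr ⟨hj.1, hjS⟩
    have hc := (card_le_card hsub).trans (card_union_le _ _)
    have hsd : (range M \ S).card = M - S.card := by rw [card_sdiff_of_subset hS, card_range]
    omega
  -- (i)+(ii) `∑_t #{j ∈ S : q^t ∣ y_j} ≤ ∑_{j ∈ S} v_q(y_j)`
  have h12 : ∑ t ∈ Ico 1 (T + 1), (S.filter fun j : ℕ => (q : ℤ) ^ t ∣ y₀ + b * (j : ℤ)).card ≤
      ∑ j ∈ S, padicValInt q (y₀ + b * j) := by
    calc ∑ t ∈ Ico 1 (T + 1), (S.filter fun j : ℕ => (q : ℤ) ^ t ∣ y₀ + b * (j : ℤ)).card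
        = ∑ j ∈ S, ((Ico 1 (T + 1)).filter fun t : ℕ => (q : ℤ) ^ t ∣ y₀ + b * (j : ℤ)).card := by
          simp only [card_filter]
          exact sum_comm
      _ ≤ ∑ j ∈ S, padicValInt q (y₀ + b * j) :=
          sum_le_sum fun j hj => card_filter_pow_dvd_le (hzero j hj) T
  -- (vi) `ℓ T ≤ v_q(D^ℓ)`
  have h6 : ℓ * T ≤ padicValInt q ((D : ℤ) ^ ℓ) := by
    rcases Nat.eq_zero_or_pos ℓ with hℓ | hℓ
    · rw [hℓ, zero_mul]; exact Nat.zero_le _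
    · have hD0 : D ≠ 0 := by
        rintro rfl
        rw [Nat.cast_zero, zero_pow hℓ.ne'] at hDℓ
        exact hDℓ rfl
      have hqT : q ^ T ∣ D := hD (q ^ T) (Nat.one_le_pow _ _ hq.pos) (Nat.pow_log_le_self q hm.ne')
      have hTle : T ≤ padicValNat q D := (padicValNat_dvd_iff_le hD0).1 hqT
      have : padicValInt q ((D : ℤ) ^ ℓ) = ℓ * padicValNat q D := by
        rw [← Nat.cast_pow, padicValInt.of_nat, padicValNat.pow]
      rw [this]
      exact Nat.mul_le_mul_left _ hTle
  -- assemble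
  have h34' : ∑ t ∈ Ico 1 (T + 1), M / q ^ t ≤
      ∑ t ∈ Ico 1 (T + 1), (S.filter fun j : ℕ => (q : ℤ) ^ t ∣ y₀ + b * (j : ℤ)).card + ℓ * T := by
    have := sum_le_sum fun t (_ : t ∈ Ico 1 (T + 1)) => h34 t
    rw [sum_add_distrib, sum_const, Nat.card_Ico, smul_eq_mul, Nat.add_sub_cancel] at this
    linarith
  linarith

/-- The coefficients of `∏_{j<M} (bX + y_j)`: `[X^ℓ] = ∑_{|t| = ℓ} b^ℓ ∏_{j ∉ t} y_j`. [folklore] -/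
private theorem coeff_prod_linear (b : ℤ) (y : ℕ → ℤ) (M ℓ : ℕ) :
    (∏ j ∈ range M, (Polynomial.C b * Polynomial.X + Polynomial.C (y j))).coeff ℓ =
      ∑ t ∈ (range M).powerset with t.card = ℓ, b ^ ℓ * ∏ j ∈ range M \ t, y j := by
  classical
  rw [prod_add, Polynomial.finsetSum_coeff, sum_filter]
  refine sum_congr rfl fun t _ => ?_
  rw [prod_const, ← map_prod Polynomial.C, mul_pow, ← map_pow, mul_assoc, mul_comm (Polynomial.X ^ _),
    ← mul_assoc, ← map_mul, Polynomial.coeff_C_mul_X_pow]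
  by_cases h : t.card = ℓ
  · subst h; simp
  · rw [if_neg (fun h' => h h'.symm), if_neg h]

/-- **Lai–Yu 2020, Proposition 3.2, general form** (PROVED): for `b ≥ 1`, integers `y₀`, lengths
`M, m ≥ 1` and any common multiple `D` of `1, …, m`, every coefficient of `∏_{j<M} (bX + y₀ + bj)`
satisfies `(m!)^{⌊M/m⌋} ∣ D^ℓ · ∏_{p∣b} p^{⌊M/(p−1)⌋} · [X^ℓ] ∏_{j<M} (bX + y₀ + bj)`. With
`M = (2r+1)n`, `m = n/den(r)`, `D = d_n`, `y₀ = a − b(rn+k)` this is the printed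
`d_n^ℓ [t^ℓ] F_{b,a}(t − k) ∈ ℤ`. [cite: LaiYu2020, Prop. 3.2] -/
theorem prop32 (b : ℕ) (hb : 0 < b) (y₀ : ℤ) (M : ℕ) {m : ℕ} (hm : 0 < m) {D : ℕ}
    (hD : ∀ i : ℕ, 1 ≤ i → i ≤ m → i ∣ D) (ℓ : ℕ) :
    ((m ! : ℤ) ^ (M / m)) ∣ (D : ℤ) ^ ℓ * (∏ p ∈ b.primeFactors, (p : ℤ) ^ (M / (p - 1))) *
      (∏ j ∈ range M, (Polynomial.C (b : ℤ) * Polynomial.X + Polynomial.C (y₀ + b * j))).coeff ℓ := by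
  classical
  set μ : ℤ := ∏ p ∈ b.primeFactors, (p : ℤ) ^ (M / (p - 1)) with hμ
  rw [coeff_prod_linear (b : ℤ) (fun j => y₀ + b * j) M ℓ, mul_sum]
  refine dvd_sum fun t ht => ?_
  simp only [mem_filter, mem_powerset] at ht
  obtain ⟨htM, htcard⟩ := ht
  -- prime-power criterion for `(m!)^{⌊M/m⌋}`
  have key : ∀ z : ℤ, (∀ (q k : ℕ), q.Prime → q ^ k ∣ (m !) ^ (M / m) → (q : ℤ) ^ k ∣ z) →
      ((m ! : ℤ) ^ (M / m)) ∣ z := by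
    intro z hz
    rw [← Nat.cast_pow, Int.natCast_dvd, Nat.dvd_iff_prime_pow_dvd_dvd]
    intro q k hq hqk
    rw [← Int.natCast_dvd, Nat.cast_pow]
    exact hz q k hq hqk
  refine key _ fun q k hq hqk => ?_
  haveI : Fact q.Prime := ⟨hq⟩
  have hk : k ≤ M / m * padicValNat q m ! := by
    have := (padicValNat_dvd_iff_le (pow_ne_zero _ (factorial_ne_zero m))).1 hqk
    rwa [padicValNat.pow] at this
  by_cases hqb : q ∣ b
  · -- `q ∣ b`: `q^k ∣ μ`
    have h1 : M / m * padicValNat q m ! ≤ M / (q - 1) := by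
      calc M / m * padicValNat q m ! ≤ M / m * (m / (q - 1)) :=
            Nat.mul_le_mul_left _ (padicValNat_factorial_le_div hq m)
        _ ≤ M / m * m / (q - 1) := Nat.mul_div_le_mul_div_assoc _ _ _
        _ ≤ M / (q - 1) := Nat.div_le_div_right (Nat.div_mul_le_self M m)
    have h2 : (q : ℤ) ^ (M / (q - 1)) ∣ μ := by
      rw [hμ]
      exact dvd_prod_of_mem _ (Nat.mem_primeFactors.2 ⟨hq, hqb, hb.ne'⟩)
    have h3 : (q : ℤ) ^ k ∣ μ := (pow_dvd_pow _ (hk.trans h1)).trans h2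
    exact dvd_mul_of_dvd_left (dvd_mul_of_dvd_right h3 _) _
  · -- `q ∤ b`: the counting core on `S = range M \ t`
    have hqb' : ¬ (q : ℤ) ∣ (b : ℤ) := by rwa [Int.natCast_dvd_natCast]
    have hS : range M \ t ⊆ range M := sdiff_subset
    have hcard : M ≤ (range M \ t).card + ℓ := by
      rw [card_sdiff_of_subset htM, card_range, htcard]; omega
    have h1 := prime_pow_dvd_pow_mul_subprod hq hqb' y₀ hm hD hS hcard
    have h2 : (q : ℤ) ^ k ∣ (D : ℤ) ^ ℓ * ∏ j ∈ range M \ t, (y₀ + b * j) :=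
      (pow_dvd_pow _ hk).trans h1
    have e : (D : ℤ) ^ ℓ * μ * ((b : ℤ) ^ ℓ * ∏ j ∈ range M \ t, (y₀ + (b : ℤ) * j)) =
        ((D : ℤ) ^ ℓ * ∏ j ∈ range M \ t, (y₀ + b * j)) * (μ * (b : ℤ) ^ ℓ) := by ring
    rw [e]
    exact dvd_mul_of_dvd_left h2 _

end Literature.NumberTheory.Irrationality.LaiYu2020
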